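import Mathlib.Analysis.InnerProductSpace.PiL2
import Mathlib.Tactic
import HarnessLib

/-!
# Cubic labels of the twelve slots: entries, signed permutations, normalisation of an edge

HONEST FRAMING. Part of the venture `Summits/Ventures/Crystal3D` (cell `crystal3d-full`), helper for the
crux `GenericWallFloor` (stmt-Ventures-19480) of `route-Ventures-StickyWulffConstant`, line `WallLedgerG`:
bookkeeping for the kernel version of the NON-SATURATION input (M5) of the rigid-bicrystal rung of
`stub_twoSlabAdhesion`.  Finite combinatorics of `ℤ³`; rung credit only.

In the cubic frame the twelve slots of `Λ₀` are the integer triples `c` with `c₀² + c₁² + c₂² = 2`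
("labels": permutations of `(±1, ±1, 0)`); two slots are ADJACENT (at `60°`) iff `c · c' = 1`.  The
symmetry group of the cuboctahedron acts on labels and on real coordinate triples alike by SIGNED
PERMUTATIONS `v ↦ (i ↦ εᵢ v(π i))` (`π` a permutation of the three axes, `εᵢ = ±1`), preserving all
dot products.  This file records the invariance lemmas and the normalisation
`exists_signedPerm_normalize`: every ordered adjacent pair of labels is carried to
`((1,1,0), (1,0,1))` by a signed permutation — so the case analysis of the next file may be done in one
frame.

WHAT THIS IS NOT: no geometry; rung F-C1 not moved.
-/

namespace Summit.Ventures.Crystal3D.Theorems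

/-- The entries of a label are `−1`, `0` or `1`. -/
theorem label_entry_trichotomy (c : Fin 3 → ℤ) (hc : c 0 ^ 2 + c 1 ^ 2 + c 2 ^ 2 = 2) (i : Fin 3) :
    c i = -1 ∨ c i = 0 ∨ c i = 1 := by
  have h0 := sq_nonneg (c 0)
  have h1 := sq_nonneg (c 1)
  have h2 := sq_nonneg (c 2)
  have hle : c i ^ 2 ≤ 2 := by fin_cases i <;> simp <;> linarith
  have hb : -1 ≤ c i ∧ c i ≤ 1 := by constructor <;> nlinarith
  omega

/-- The zero pattern of a label: exactly one entry vanishes, the other two are `±1`. -/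
theorem label_zero_pattern (c : Fin 3 → ℤ) (hc : c 0 ^ 2 + c 1 ^ 2 + c 2 ^ 2 = 2) :
    (c 0 = 0 ∧ c 1 ^ 2 = 1 ∧ c 2 ^ 2 = 1) ∨ (c 1 = 0 ∧ c 0 ^ 2 = 1 ∧ c 2 ^ 2 = 1) ∨
      (c 2 = 0 ∧ c 0 ^ 2 = 1 ∧ c 1 ^ 2 = 1) := by
  rcases label_entry_trichotomy c hc 0 with h0 | h0 | h0 <;>
  rcases label_entry_trichotomy c hc 1 with h1 | h1 | h1 <;>
  rcases label_entry_trichotomy c hc 2 with h2 | h2 | h2 <;>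
  rw [h0, h1, h2] at hc ⊢ <;> omega

/-! ## Signed permutations preserve dot products -/

/-- Integer dot products are invariant under a signed permutation. -/
theorem signedPerm_dot_int (π : Equiv.Perm (Fin 3)) (ε : Fin 3 → ℤ) (hε : ∀ i, ε i ^ 2 = 1)
    (a b : Fin 3 → ℤ) :
    (ε 0 * a (π 0)) * (ε 0 * b (π 0)) + (ε 1 * a (π 1)) * (ε 1 * b (π 1)) +
        (ε 2 * a (π 2)) * (ε 2 * b (π 2)) = a 0 * b 0 + a 1 * b 1 + a 2 * b 2 := by
  have e : ∀ i, (ε i * a (π i)) * (ε i * b (π i)) = (fun j => a j * b j) (π i) := by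
    intro i
    have h := hε i
    calc (ε i * a (π i)) * (ε i * b (π i)) = ε i ^ 2 * (a (π i) * b (π i)) := by ring
      _ = a (π i) * b (π i) := by rw [h, one_mul]
  rw [e 0, e 1, e 2]
  have h := Equiv.sum_comp π (fun j => a j * b j)
  rw [Fin.sum_univ_three, Fin.sum_univ_three] at h
  exact h

/-- Real dot products are invariant under a signed permutation. -/
theorem signedPerm_dot_real (π : Equiv.Perm (Fin 3)) (ε : Fin 3 → ℤ) (hε : ∀ i, ε i ^ 2 = 1)
    (D D' : Fin 3 → ℝ) :
    ((ε 0 : ℝ) * D (π 0)) * ((ε 0 : ℝ) * D' (π 0)) + ((ε 1 : ℝ) * D (π 1)) * ((ε 1 : ℝ) * D' (π 1)) +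
        ((ε 2 : ℝ) * D (π 2)) * ((ε 2 : ℝ) * D' (π 2)) = D 0 * D' 0 + D 1 * D' 1 + D 2 * D' 2 := by
  have hεR : ∀ i, ((ε i : ℝ)) ^ 2 = 1 := fun i => by exact_mod_cast hε i
  have e : ∀ i, ((ε i : ℝ) * D (π i)) * ((ε i : ℝ) * D' (π i)) = (fun j => D j * D' j) (π i) := by
    intro i
    have h := hεR i
    calc ((ε i : ℝ) * D (π i)) * ((ε i : ℝ) * D' (π i)) = ((ε i : ℝ)) ^ 2 * (D (π i) * D' (π i)) := by ring
      _ = D (π i) * D' (π i) := by rw [h, one_mul]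
  rw [e 0, e 1, e 2]
  have h := Equiv.sum_comp π (fun j => D j * D' j)
  rw [Fin.sum_univ_three, Fin.sum_univ_three] at h
  exact h

/-- Mixed (label · real) dot products are invariant under a signed permutation. -/
theorem signedPerm_dot_mixed (π : Equiv.Perm (Fin 3)) (ε : Fin 3 → ℤ) (hε : ∀ i, ε i ^ 2 = 1)
    (c : Fin 3 → ℤ) (D : Fin 3 → ℝ) :
    ((ε 0 * c (π 0) : ℤ) : ℝ) * ((ε 0 : ℝ) * D (π 0)) + ((ε 1 * c (π 1) : ℤ) : ℝ) * ((ε 1 : ℝ) * D (π 1)) +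
        ((ε 2 * c (π 2) : ℤ) : ℝ) * ((ε 2 : ℝ) * D (π 2)) =
      (c 0 : ℝ) * D 0 + (c 1 : ℝ) * D 1 + (c 2 : ℝ) * D 2 := by
  have hεR : ∀ i, ((ε i : ℝ)) ^ 2 = 1 := fun i => by exact_mod_cast hε i
  have e : ∀ i, ((ε i * c (π i) : ℤ) : ℝ) * ((ε i : ℝ) * D (π i)) = (fun j => (c j : ℝ) * D j) (π i) := by
    intro i
    have h := hεR i
    push_cast
    calc ((ε i : ℝ) * (c (π i) : ℝ)) * ((ε i : ℝ) * D (π i)) = ((ε i : ℝ)) ^ 2 * ((c (π i) : ℝ) * D (π i)) := by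
          ring
      _ = (c (π i) : ℝ) * D (π i) := by rw [h, one_mul]
  rw [e 0, e 1, e 2]
  have h := Equiv.sum_comp π (fun j => (c j : ℝ) * D j)
  rw [Fin.sum_univ_three, Fin.sum_univ_three] at h
  exact h

/-- A signed permutation is injective on real triples. -/
theorem signedPerm_injective_real (π : Equiv.Perm (Fin 3)) (ε : Fin 3 → ℤ) (hε : ∀ i, ε i ^ 2 = 1) :
    Function.Injective (fun D : Fin 3 → ℝ => fun i => (ε i : ℝ) * D (π i)) := by
  intro D D' h
  have hεR : ∀ i, ((ε i : ℝ)) ^ 2 = 1 := fun i => by exact_mod_cast hε i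
  have hε0 : ∀ i, (ε i : ℝ) ≠ 0 := by
    intro i h0; have := hεR i; rw [h0] at this; norm_num at this
  funext j
  have hj := congrFun h (π.symm j)
  simp only [Equiv.apply_symm_apply] at hj
  exact mul_left_cancel₀ (hε0 _) hj

/-- A signed permutation is injective on labels. -/
theorem signedPerm_injective_int (π : Equiv.Perm (Fin 3)) (ε : Fin 3 → ℤ) (hε : ∀ i, ε i ^ 2 = 1) :
    Function.Injective (fun c : Fin 3 → ℤ => fun i => ε i * c (π i)) := by
  intro c c' h
  have hε0 : ∀ i, ε i ≠ 0 := by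
    intro i h0; have := hε i; rw [h0] at this; norm_num at this
  funext j
  have hj := congrFun h (π.symm j)
  simp only [Equiv.apply_symm_apply] at hj
  exact mul_left_cancel₀ (hε0 _) hj

/-- Undoing a signed permutation on labels: `c = g (g⁻¹ c)` with `(g⁻¹ c) j = ε (π⁻¹ j) c (π⁻¹ j)`. -/
theorem signedPerm_apply_symm (π : Equiv.Perm (Fin 3)) (ε : Fin 3 → ℤ) (hε : ∀ i, ε i ^ 2 = 1)
    (c : Fin 3 → ℤ) (i : Fin 3) :
    ε i * (fun j => ε (π.symm j) * c (π.symm j)) (π i) = c i := by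
  simp only [Equiv.symm_apply_apply]
  have := hε i
  have e : ε i * (ε i * c i) = ε i ^ 2 * c i := by ring
  rw [e, this, one_mul]

/-! ## Normalising an ordered adjacent pair of labels -/

/-- **Normalisation.**  For labels `a, b` (`Σ aᵢ² = Σ bᵢ² = 2`) with `a · b = 1` there is a signed
permutation carrying `a` to `(1,1,0)` and `b` to `(1,0,1)`. -/
theorem exists_signedPerm_normalize (a b : Fin 3 → ℤ) (ha : a 0 ^ 2 + a 1 ^ 2 + a 2 ^ 2 = 2)
    (hb : b 0 ^ 2 + b 1 ^ 2 + b 2 ^ 2 = 2) (hab : a 0 * b 0 + a 1 * b 1 + a 2 * b 2 = 1) :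
    ∃ (π : Equiv.Perm (Fin 3)) (ε : Fin 3 → ℤ), (∀ i, ε i ^ 2 = 1) ∧
      (ε 0 * a (π 0) = 1 ∧ ε 1 * a (π 1) = 1 ∧ ε 2 * a (π 2) = 0) ∧
      (ε 0 * b (π 0) = 1 ∧ ε 1 * b (π 1) = 0 ∧ ε 2 * b (π 2) = 1) := by
  -- entries
  have ta := label_entry_trichotomy a ha
  have tb := label_entry_trichotomy b hb
  -- explicit permutations of `Fin 3`
  let p012 : Equiv.Perm (Fin 3) := Equiv.refl _
  let p021 : Equiv.Perm (Fin 3) := ⟨![0, 2, 1], ![0, 2, 1], by decide, by decide⟩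
  let p102 : Equiv.Perm (Fin 3) := ⟨![1, 0, 2], ![1, 0, 2], by decide, by decide⟩
  let p120 : Equiv.Perm (Fin 3) := ⟨![1, 2, 0], ![2, 0, 1], by decide, by decide⟩
  let p201 : Equiv.Perm (Fin 3) := ⟨![2, 0, 1], ![1, 2, 0], by decide, by decide⟩
  let p210 : Equiv.Perm (Fin 3) := ⟨![2, 1, 0], ![2, 1, 0], by decide, by decide⟩
  rcases label_zero_pattern a ha with ⟨ha0, ha1, ha2⟩ | ⟨ha1, ha0, ha2⟩ | ⟨ha2, ha0, ha1⟩ <;>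
  rcases label_zero_pattern b hb with ⟨hb0, hb1, hb2⟩ | ⟨hb1, hb0, hb2⟩ | ⟨hb2, hb0, hb1⟩
  · -- same zero index `0`: `a·b` would be even
    exfalso
    rcases ta 1 with h1 | h1 | h1 <;> rcases ta 2 with h2 | h2 | h2 <;>
    rcases tb 1 with k1 | k1 | k1 <;> rcases tb 2 with k2 | k2 | k2 <;>
    simp only [h1, h2, k1, k2] at hab ha1 ha2 hb1 hb2 <;>
    first | (norm_num at ha1; done) | (norm_num at ha2; done) | (norm_num at hb1; done) |
      (norm_num at hb2; done) | (rw [ha0, hb0] at hab; norm_num at hab)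
  · -- `a 0 = 0`, `b 1 = 0`: shared index `2`, `a`-only index `1`, `b`-only index `0`
    have hs : a 2 * b 2 = 1 := by rw [ha0, hb1] at hab; linarith
    refine ⟨p210, ![a 2, a 1, b 0], fun i => ?_, ⟨?_, ?_, ?_⟩, ⟨?_, ?_, ?_⟩⟩
    · fin_cases i
      · exact ha2
      · exact ha1
      · exact hb0
    · show a 2 * a 2 = 1
      nlinarith [ha2]
    · show a 1 * a 1 = 1
      nlinarith [ha1]
    · show b 0 * a 0 = 0
      rw [ha0]; ring
    · show a 2 * b 2 = 1
      exact hs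
    · show a 1 * b 1 = 0
      rw [hb1]; ring
    · show b 0 * b 0 = 1
      nlinarith [hb0]
  · -- `a 0 = 0`, `b 2 = 0`: shared index `1`, `a`-only index `2`, `b`-only index `0`
    have hs : a 1 * b 1 = 1 := by rw [ha0, hb2] at hab; linarith
    refine ⟨p120, ![a 1, a 2, b 0], fun i => ?_, ⟨?_, ?_, ?_⟩, ⟨?_, ?_, ?_⟩⟩
    · fin_cases i
      · exact ha1
      · exact ha2
      · exact hb0
    · show a 1 * a 1 = 1
      nlinarith [ha1]
    · show a 2 * a 2 = 1
      nlinarith [ha2]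
    · show b 0 * a 0 = 0
      rw [ha0]; ring
    · show a 1 * b 1 = 1
      exact hs
    · show a 2 * b 2 = 0
      rw [hb2]; ring
    · show b 0 * b 0 = 1
      nlinarith [hb0]
  · -- `a 1 = 0`, `b 0 = 0`: shared index `2`, `a`-only index `0`, `b`-only index `1`
    have hs : a 2 * b 2 = 1 := by rw [ha1, hb0] at hab; linarith
    refine ⟨p201, ![a 2, a 0, b 1], fun i => ?_, ⟨?_, ?_, ?_⟩, ⟨?_, ?_, ?_⟩⟩
    · fin_cases i
      · exact ha2
      · exact ha0
      · exact hb1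
    · show a 2 * a 2 = 1
      nlinarith [ha2]
    · show a 0 * a 0 = 1
      nlinarith [ha0]
    · show b 1 * a 1 = 0
      rw [ha1]; ring
    · show a 2 * b 2 = 1
      exact hs
    · show a 0 * b 0 = 0
      rw [hb0]; ring
    · show b 1 * b 1 = 1
      nlinarith [hb1]
  · -- same zero index `1`: `a·b` would be even
    exfalso
    rcases ta 0 with h1 | h1 | h1 <;> rcases ta 2 with h2 | h2 | h2 <;>
    rcases tb 0 with k1 | k1 | k1 <;> rcases tb 2 with k2 | k2 | k2 <;>
    simp only [h1, h2, k1, k2] at hab ha0 ha2 hb0 hb2 <;>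
    first | (norm_num at ha0; done) | (norm_num at ha2; done) | (norm_num at hb0; done) |
      (norm_num at hb2; done) | (rw [ha1, hb1] at hab; norm_num at hab)
  · -- `a 1 = 0`, `b 2 = 0`: shared index `0`, `a`-only index `2`, `b`-only index `1`
    have hs : a 0 * b 0 = 1 := by rw [ha1, hb2] at hab; linarith
    refine ⟨p021, ![a 0, a 2, b 1], fun i => ?_, ⟨?_, ?_, ?_⟩, ⟨?_, ?_, ?_⟩⟩
    · fin_cases i
      · exact ha0
      · exact ha2
      · exact hb1
    · show a 0 * a 0 = 1
      nlinarith [ha0]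
    · show a 2 * a 2 = 1
      nlinarith [ha2]
    · show b 1 * a 1 = 0
      rw [ha1]; ring
    · show a 0 * b 0 = 1
      exact hs
    · show a 2 * b 2 = 0
      rw [hb2]; ring
    · show b 1 * b 1 = 1
      nlinarith [hb1]
  · -- `a 2 = 0`, `b 0 = 0`: shared index `1`, `a`-only index `0`, `b`-only index `2`
    have hs : a 1 * b 1 = 1 := by rw [ha2, hb0] at hab; linarith
    refine ⟨p102, ![a 1, a 0, b 2], fun i => ?_, ⟨?_, ?_, ?_⟩, ⟨?_, ?_, ?_⟩⟩
    · fin_cases i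
      · exact ha1
      · exact ha0
      · exact hb2
    · show a 1 * a 1 = 1
      nlinarith [ha1]
    · show a 0 * a 0 = 1
      nlinarith [ha0]
    · show b 2 * a 2 = 0
      rw [ha2]; ring
    · show a 1 * b 1 = 1
      exact hs
    · show a 0 * b 0 = 0
      rw [hb0]; ring
    · show b 2 * b 2 = 1
      nlinarith [hb2]
  · -- `a 2 = 0`, `b 1 = 0`: shared index `0`, `a`-only index `1`, `b`-only index `2`
    have hs : a 0 * b 0 = 1 := by rw [ha2, hb1] at hab; linarith
    refine ⟨p012, ![a 0, a 1, b 2], fun i => ?_, ⟨?_, ?_, ?_⟩, ⟨?_, ?_, ?_⟩⟩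
    · fin_cases i
      · exact ha0
      · exact ha1
      · exact hb2
    · show a 0 * a 0 = 1
      nlinarith [ha0]
    · show a 1 * a 1 = 1
      nlinarith [ha1]
    · show b 2 * a 2 = 0
      rw [ha2]; ring
    · show a 0 * b 0 = 1
      exact hs
    · show a 1 * b 1 = 0
      rw [hb1]; ring
    · show b 2 * b 2 = 1
      nlinarith [hb2]
  · -- same zero index `2`: `a·b` would be even
    exfalso
    rcases ta 0 with h1 | h1 | h1 <;> rcases ta 1 with h2 | h2 | h2 <;>
    rcases tb 0 with k1 | k1 | k1 <;> rcases tb 1 with k2 | k2 | k2 <;>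
    simp only [h1, h2, k1, k2] at hab ha0 ha1 hb0 hb1 <;>
    first | (norm_num at ha0; done) | (norm_num at ha1; done) | (norm_num at hb0; done) |
      (norm_num at hb1; done) | (rw [ha2, hb2] at hab; norm_num at hab)

end Summit.Ventures.Crystal3D.Theorems
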